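import Literature.NumberTheory.Transcendental.KZSemiCanonicalReductionProofs
import Literature.ModelTheory.ExponentialFields.SemialgebraicC1Cells
import HarnessLib

/-!
# `ContinuousCubification` (stmt-KontsevichZagierPeriods-17853) — line `SketchIdeator1`, stub `stub_volumeToCells`

Registered stub S2 of the line `korobov_damping` / `SketchIdeator1` of the crux `ContinuousCubification`
(route UnfoldedStokes): **a bounded unit solid is the sum of its open cells.**

Let `V = [σ, 1]` be an integral representation of the Kontsevich–Zagier calculus with bounded
domain `σ ⊆ ℝᴺ` and integrand `1` on `σ`, and let `𝒟` be a cylindrical decomposition of `ℝᴺ` into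
`ℚ`-semialgebraic `C¹` cells adapted to `σ` (every cell lies in `σ` or misses it). Then
`[V] ≡ Σ_{C ∈ 𝒞} [C, 1]` modulo the moves (`KZ.relations`), where `𝒞` is the family of
top-dimensional (open) cells of `𝒟` contained in `σ` and `[C, 1]` is the restriction of `V` to `C`.

Proof. Iterated domain additivity over a finite almost-partition
(`KZ.of_sub_sum_of_mem_relations`): the cells of `𝒞` lie in `σ`, carry the integrand of `V`, and
are pairwise disjoint (the cells of `𝒟` partition `ℝᴺ`); the part of `σ` they do not cover is
contained in the union of the cells of `𝒟` of dimension `< N`, each of which has empty interior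
(`IsSACell.interior_eq_empty`) and is therefore Lebesgue-null, being `ℚ`-semialgebraic
(`KZ.volume_eq_zero_of_interior_eq_empty`).

References: M. Kontsevich, D. Zagier, *Periods* (2001), §1.2 (rule (1)); L. van den Dries, *Tame
topology and o-minimal structures* (1998), Ch. 3 (2.3)–(2.4), Ch. 7 (3.1)–(3.2).
-/

noncomputable section

-- `Summit.KontsevichZagierPeriods.KontsevichZagierPeriods.…` is the tree's mandated layout (single-conjunct summit).
set_option linter.dupNamespace false

namespace Summit.KontsevichZagierPeriods.KontsevichZagierPeriods.ContinuousCubificationLine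

open MeasureTheory Set
open Literature.NumberTheory.Transcendental
open Literature.NumberTheory.Transcendental.KZ
open Literature.ModelTheory.ExponentialFields (IsSemialgebraic IsSACell IsC1SACell
  IsCylindricalDecomposition)

/-! ## Thin cells are null -/

/-- A `ℚ`-semialgebraic `C¹` cell of `ℝᴺ` which is not an `N`-dimensional `C¹` cell is
Lebesgue-null: its dimension is `< N`, so its interior is empty ([Dries1998, Ch. 3 (2.4)]), and a
`ℚ`-semialgebraic set with empty interior is null. [folklore] -/
theorem volume_eq_zero_of_not_isC1SACell {N : ℕ} {C : Set (Fin N → ℝ)}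
    (hC : IsSemialgebraic ℚ C) (hcell : ∃ d, IsC1SACell ℚ N d C) (hnot : ¬ IsC1SACell ℚ N N C) :
    volume C = 0 := by
  obtain ⟨d, hd⟩ := hcell
  have hdN : d < N := by
    refine lt_of_le_of_ne hd.isSACell.le fun h => ?_
    subst h
    exact hnot hd
  exact volume_eq_zero_of_interior_eq_empty hC (hd.isSACell.interior_eq_empty hdN)

/-! ## The stub -/

/-- **Registered stub `stub_volumeToCells` (S2): a bounded unit solid is the sum of its open
cells.** Given a cylindrical decomposition `𝒟` of `ℝᴺ` into `ℚ`-`C¹` cells adapted to the bounded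
domain of `V` (integrand `1`), `[V] ≡ Σ_{C ∈ 𝒞} [C, 1]` modulo `KZ.relations`, where `𝒞` are the
`N`-dimensional cells of `𝒟` contained in the domain and `[C, 1]` is `V` restricted to `C`:
iterated domain additivity over the finite partition (`KZ.of_sub_sum_of_mem_relations`), the cells
of dimension `< N` being null (`volume_eq_zero_of_not_isC1SACell`).
[cite: KontsevichZagier2001, §1.2] -/
theorem stub_volumeToCells :
    ∀ (N : ℕ) (V : IntegralRep N), Bornology.IsBounded V.domain →
      (∀ z ∈ V.domain, V.integrand z = 1) →
      ∀ 𝒟 : Finset (Set (Fin N → ℝ)), IsCylindricalDecomposition ℚ N 𝒟 →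
        (∀ C ∈ 𝒟, ∃ d, IsC1SACell ℚ N d C) → (∀ C ∈ 𝒟, C ⊆ V.domain ∨ Disjoint C V.domain) →
        ∃ (𝒞 : Finset (Set (Fin N → ℝ))) (R : Set (Fin N → ℝ) → IntegralRep N),
          (∀ C ∈ 𝒞, (R C).domain = C ∧ IsC1SACell ℚ N N C ∧ Bornology.IsBounded C ∧
            ∀ z ∈ C, (R C).integrand z = 1) ∧
          of V - ∑ C ∈ 𝒞, of (R C) ∈ relations := by
  classical
  intro N V hb h1 𝒟 h𝒟 hcell hadapt
  -- the top-dimensional cells inside the domain, and `V` restricted to them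
  set 𝒞 : Finset (Set (Fin N → ℝ)) := 𝒟.filter fun C => C ⊆ V.domain ∧ IsC1SACell ℚ N N C
    with h𝒞
  let R : Set (Fin N → ℝ) → IntegralRep N := fun C =>
    if h : IsSemialgebraic ℚ C ∧ C ⊆ V.domain then V.restrict C h.1 h.2 else V
  have hmem : ∀ C ∈ 𝒞, C ∈ 𝒟 ∧ C ⊆ V.domain ∧ IsC1SACell ℚ N N C := fun C hC => by
    simpa [h𝒞, Finset.mem_filter] using hC
  have hRC : ∀ C ∈ 𝒞, (R C).domain = C ∧ (R C).integrand = V.integrand := by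
    intro C hC
    obtain ⟨hCD, hsub, -⟩ := hmem C hC
    have h : IsSemialgebraic ℚ C ∧ C ⊆ V.domain := ⟨h𝒟.isSemialgebraic C hCD, hsub⟩
    simp only [R, dif_pos h]
    exact ⟨rfl, rfl⟩
  refine ⟨𝒞, R, fun C hC => ?_, ?_⟩
  · obtain ⟨-, hsub, hcellC⟩ := hmem C hC
    obtain ⟨hdom, hint⟩ := hRC C hC
    exact ⟨hdom, hcellC, hb.subset hsub, fun z hz => by rw [hint]; exact h1 z (hsub hz)⟩
  · refine of_sub_sum_of_mem_relations 𝒞 V R (fun C hC => ?_) (fun C hC z _ => ?_) ?_ ?_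
    · -- (i) the cells of `𝒞` lie in the domain
      rw [(hRC C hC).1, Set.sdiff_eq_empty.mpr (hmem C hC).2.1, measure_empty]
    · -- (ii) they carry the integrand of `V`
      rw [(hRC C hC).2]
    · -- (iii) the uncovered part of the domain lies in the thin cells, which are null
      have hsub : V.domain \ ⋃ C ∈ 𝒞, (R C).domain ⊆
          ⋃ C ∈ (𝒟.filter fun C => ¬ IsC1SACell ℚ N N C), C := by
        intro z hz
        obtain ⟨C, ⟨hCD, hzC⟩, -⟩ := h𝒟.isPartition.2 z
        rw [Finset.mem_coe] at hCD
        have hCV : C ⊆ V.domain := (hadapt C hCD).resolve_right fun hdis =>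
          Set.disjoint_left.mp hdis hzC hz.1
        have hnot : ¬ IsC1SACell ℚ N N C := fun hNC => by
          have hC𝒞 : C ∈ 𝒞 := by
            rw [h𝒞, Finset.mem_filter]
            exact ⟨hCD, hCV, hNC⟩
          exact hz.2 (Set.mem_biUnion (t := fun C => (R C).domain) hC𝒞
            (by rw [(hRC C hC𝒞).1]; exact hzC))
        exact Set.mem_biUnion (t := fun C => C) (Finset.mem_filter.mpr ⟨hCD, hnot⟩) hzC
      refine measure_mono_null hsub
        ((measure_biUnion_null_iff (Finset.countable_toSet _)).2 fun C hC => ?_)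
      rw [Finset.mem_coe, Finset.mem_filter] at hC
      exact volume_eq_zero_of_not_isC1SACell (h𝒟.isSemialgebraic C hC.1) (hcell C hC.1) hC.2
    · -- (iv) distinct cells are disjoint
      intro C hC C' hC' hne
      rw [(hRC C hC).1, (hRC C' hC').1]
      have hdis : Disjoint C C' := h𝒟.isPartition.pairwiseDisjoint
        (Finset.mem_coe.mpr (hmem C hC).1) (Finset.mem_coe.mpr (hmem C' hC').1) hne
      rw [hdis.inter_eq, measure_empty]

end Summit.KontsevichZagierPeriods.KontsevichZagierPeriods.ContinuousCubificationLine

end
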